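import Summits.BirchSwinnertonDyer.BirchSwinnertonDyer.Theorems.GoldfeldAllTwistsTwoConverseTwinBirchLemmaFormula
import Summits.BirchSwinnertonDyer.BirchSwinnertonDyer.Theorems.GoldfeldAllTwistsTwoConverseTwinBirchHalvability
import Summits.BirchSwinnertonDyer.BirchSwinnertonDyer.Theorems.GoldfeldAllTwistsTwoConverseTwinBirchTamagawa
import Summits.BirchSwinnertonDyer.BirchSwinnertonDyer.Theorems.GoldfeldAllTwistsTwoConverseTwinBirchFixedCurve
import Summits.BirchSwinnertonDyer.BirchSwinnertonDyer.Theorems.GoldfeldAllTwistsTwoConverseTwinGenusOddMultipleTwists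
import Summits.BirchSwinnertonDyer.BirchSwinnertonDyer.Theorems.GoldfeldAllTwistsTwoConverseTwinGenusOddMultipleTrace
import Summits.BirchSwinnertonDyer.BirchSwinnertonDyer.Theorems.GoldfeldAllTwistsTwoConverseTwinGenusOddMultipleWitness
import Summits.BirchSwinnertonDyer.BirchSwinnertonDyer.Theorems.GoldfeldAllTwistsTwoConverseTwinGenusPeriodsTwist
import Literature.NumberTheory.QuadraticFields.ImaginaryResiduePiForm
import HarnessLib

set_option linter.dupNamespace false -- `…BirchSwinnertonDyer.BirchSwinnertonDyer…` is the cell's namespace (D-0017)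
set_option autoImplicit false

/-!
# LINE B49 — THEOREM B: clause (ii) of the even-discriminant Birch lemma `X049BirchLemmaEvenDiscr` — hence
# **twin″ = `BSD(W, 2)` for every minimal model `W` of `49a1^{(−q)}`, for EVERY prime `q ≡ 1 (mod 4)` inert in
# `ℚ(√−7)`** — modulo Theorem A of the genus mechanism (`X049GenusTheoremA`) and the line's printed inputs

Cell `bsd-goldfeld`, seat `bsd-goldfeld-s1p-c301` (prover, gen 8); planner ruling g19 (liii) (B2); scope memo
`HOME/GENUS-THEOREM-B.md`. `--supports stmt-BirchSwinnertonDyer-19140` (route decl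
`Theses.GoldfeldAllTwistsTwoConverse.BSDTwoCMSevenAdditiveRankOne`, twin″) as a HELPER — the inert prime-twist
family has twist-density ZERO (a WITNESS family on the formula axis, planner ruling §3 (iv)); nothing here closes the
item and BSD is NOT proved by any of this. HONEST FRAMING OF THE INPUTS: the theorems below take as NAMED binders
(never restated) `X049GenusTheoremA` (seat c3's `@[conjecture]`-tagged input, DISCHARGED from print by seat c3 g8's
`x049GenusTheoremA_of_print`, p502529; the print-only corollaries of this file are in the sibling leaf
`…TwinBirchTheoremBPrint`), Darmon 2004 Thm 3.6 and Shimura reciprocity at conductor `1` as `∀K`-schemas (`h36`,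
`hrec`), ONE parametrisation datum of `X₀(49)` at level `49` with Manin multiplier `±1` (`hD₀`; from
`OptimalCurveManinCertificate cm7` by seat c3's `…_of_certificate` pattern), Coates–Li–Tian–Zhai 2015 Thm 1.2
(`h12`), Burungale–Flach 2024 (`hBF`), Gross–Zagier (`hGZ`), Kolyvagin (`hKo`), GZK (`hGZK`), Heegner-point
rationality (`hHP`) and Modularity (`hnf`) — exactly the binder set of the existing B49 consumers plus Theorem A.

WHY `X049GenusTheoremA` AND NOT `X049GenusPointOddMultiple`: clause (ii) is the EXACT valuation
`ord₂ [X₀(49)(K) : ℤP] = 1 + ord₂(Dt.c)` for the datum's own Heegner point; the OddMultiple input forgets that the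
scaling is `n = D₀.c·Dt.c` and that the odd-type point is `K`-rational (memo §0), so we re-run seat c3's witness
construction (`genusPointOddMultiple_witness`) keeping both (§1).

THE PROOF (factor table of the memo; `𝔮₄₉ = 8 I² t_W² / (n_∞ k² t_K² c² w_K² tq |u| c_W)`):
* `I = [X₀(49)(K) : ℤP] = 2·|D₀.c·Dt.c|·m`, `m` ODD (§§1–2: the trace `P_K` of `y(1)` is `K`-rational with
  `P = (D₀.c·Dt.c) • P_K` (`map_eq_zsmul_sum_algEquiv_of_abs_c_eq_one`), `P_K ∉ 2X₀(49)(K) + tors` by the genus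
  descent + Theorem A (`cm7_odd_zsmul_ne_two_zsmul_add_of_genusData`), `X₀(49)(K) ≅ ℤg ⊕ ℤ/2` (rank `1` by
  GZ–Kolyvagin, `shaAn_eq_x049Quotient_inertPrimeTwist`; `#tors = 2`, file B1c-α), index formula
  `KrizLi2019.index_zmultiples_eq`);
* `t_W = 2` (`torsionOrder_eq_two_of_j_eq`), `n_∞ = 1` (`numRealComponents_cm7`), **`k = 1`** (file B1c-β: the
  `k = 2` branch contradicts `not_forall_halvable_inertPrimeTwist`), `t_K = 2` (B1c-α), `w_K = 2`
  (`torsionOrder_eq_two_of_discr_lt_neg_four`), `ord₂ tq = −1` (B1d, `h12`), `|u| = 1` (B1d), `c_W = 16` (B1b′);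
* hence `𝔮₄₉ = m²/(2·tq)` and `ord₂ 𝔮₄₉ = 0 − 1 + 1 = 0`.
MAIN STATEMENTS: `x049BirchLemmaEvenDiscr_of_theoremA` (B49 in full), and through seat c301 gen 4's consumers
`bsdp_two_inertPrimeTwist_of_theoremA` (**`BSDp W 2` for every globally minimal model of `49a1^{(−q)}`, every prime
`q ≡ 1 (mod 4)` with `(−7/q) = −1`**); «D(q)» for all these `q` is seat c3's `analyticRank_eq_one_inertPrimeTwist_of_print`
(not re-derived here).
References: [Gross1984] §§4–5; [GrossLMS1991] §§3–4; [CaiShuTian2014] Thm 1.1; [CoatesLiTianZhai2015] Thm 1.2;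
[BurungaleFlach2024] Cor. 2; [GrossZagier1986] I.(6.3); [Miller2011LMS] Def. 1.1; [SilvermanTate2015] §3.5–3.6;
[BurungaleCastellaSkinnerTian2022] Rem. D (the even-discriminant gap).
-/

noncomputable section

open scoped Classical

open scoped IntermediateField

open WeierstrassCurve NumberField Literature.NumberTheory Literature.NumberTheory.EllipticCurves
  Literature.NumberTheory.EllipticCurves.ModularForms WeierstrassCurve.QuadraticDescent
  Summit.BirchSwinnertonDyer.Rank1Residual.P2

namespace Summit.BirchSwinnertonDyer.BirchSwinnertonDyer.Theorems.GoldfeldGoodTwists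

variable {K : Type} [Field K] [NumberField K]

/-! ## §1 The `K`-rational trace of `y(1)` is of ODD type (seat c3's witness construction, keeping `P_K` and `n`) -/

section RatTrace

/-- **The `K`-rational trace and its odd type.** In the setting of seat c3's `genusPointOddMultiple_witness` (`q` prime,
`(q/7) = −1`, `K` imaginary quadratic with `d_K = −4q`, `L/K` finite Galois with `r₀² = q`, `y₁ ∈ X₀(49)(L)`, the trace
relation `P = n • Σ_σ σ y₁`, and Theorem A in Galois-sum currency): there is `P_K ∈ X₀(49)(K)` with `P = n • P_K`
(the SAME `n`) and `P_K ∉ 2X₀(49)(K) + X₀(49)(K)_tors`. [cite: Gross1984, §§4–5] [cite: Tian2014, §1 (1.3)] -/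
theorem exists_ratTrace_oddType (hK : IsImaginaryQuadratic K) {q : ℕ} (hq : q.Prime) (hq7 : jacobiSym q 7 = -1)
    (hdK : NumberField.discr K = -(4 * (q : ℤ))) (P : (cm7.baseChange K).toAffine.Point)
    {L : Type} [Field L] [CharZero L] [Algebra K L] [FiniteDimensional K L] [IsGalois K L]
    {r₀ : L} (hr : r₀ ^ 2 = algebraMap K L ((q : ℕ) : K))
    (y₁ : (cm7.baseChange L).toAffine.Point) {n : ℤ}
    (htr : Affine.Point.map (algebraMap K L).toRatAlgHom P =
      n • ∑ σ : L ≃ₐ[K] L, Affine.Point.map (σ : L →ₐ[K] L) y₁)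
    (hA : ∃ (i : L) (hi : (cm7.baseChange L).toAffine.Nonsingular 0 i) (μ l : ℤ), Odd l ∧
      IsOfFinAddOrder (μ • (∑ σ : L ≃ₐ[K] L, (if σ r₀ = r₀ then (1 : ℤ) else -1) •
        Affine.Point.map (σ : L →ₐ[K] L) y₁) - l • Affine.Point.some 0 i hi)) :
    ∃ PK : (cm7.baseChange K).toAffine.Point, P = n • PK ∧
      ∀ R t : (cm7.baseChange K).toAffine.Point, IsOfFinAddOrder t → PK ≠ (2 : ℤ) • R + t := by
  obtain ⟨i, hi, μ, l, hl, hAt⟩ := hA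
  have hqK : ¬ IsSquare ((q : ℕ) : K) := not_isSquare_natCast_of_discr_eq hK hq hdK
  have hfin : Module.finrank K K⟮r₀⟯ = 2 := finrank_adjoin_sqrt_eq_two (L := L) hr hqK
  set fKL : (cm7.baseChange K).toAffine.Point →+ (cm7.baseChange L).toAffine.Point :=
    Affine.Point.map (W' := cm7) (algebraMap K L).toRatAlgHom with hfKL
  set fKH : (cm7.baseChange K).toAffine.Point →+ (cm7.baseChange K⟮r₀⟯).toAffine.Point :=
    Affine.Point.map (W' := cm7) (algebraMap K K⟮r₀⟯).toRatAlgHom with hfKH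
  set fHL : (cm7.baseChange K⟮r₀⟯).toAffine.Point →+ (cm7.baseChange L).toAffine.Point :=
    Affine.Point.map (W' := cm7) (algebraMap K⟮r₀⟯ L).toRatAlgHom with hfHL
  have hcomp : ∀ Q : (cm7.baseChange K).toAffine.Point, fHL (fKH Q) = fKL Q := by
    intro Q
    rw [hfHL, hfKH, Affine.Point.map_map]
    exact point_map_congr _ _ (fun x => (IsScalarTower.algebraMap_apply K K⟮r₀⟯ L x).symm) Q
  have hinjHL : Function.Injective fHL :=
    Affine.Point.map_injective (W' := cm7) ((algebraMap K⟮r₀⟯ L).toRatAlgHom)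
  have hinjKH : Function.Injective fKH :=
    Affine.Point.map_injective (W' := cm7) ((algebraMap K K⟮r₀⟯).toRatAlgHom)
  -- `i ∈ K⟮r₀⟯`
  obtain ⟨δ, hδ, -, -⟩ := exists_sq_eq_discr_and_span hK
  have hδ2 : (algebraMap K L δ) ^ 2 = -(4 * (q : L)) := by
    rw [← map_pow, hδ, hdK]
    simp [map_neg, map_mul, map_ofNat, map_natCast]
  have hi2 : i ^ 2 = -1 := sq_eq_neg_one_of_nonsingular_zero hi
  have hq0 : (q : L) ≠ 0 := by exact_mod_cast hq.ne_zero
  have hr' : r₀ ^ 2 = (q : L) := by rw [hr, map_natCast]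
  have hw2 : (algebraMap K L δ * r₀ / (2 * q)) ^ 2 = -1 := by
    rw [div_pow, mul_pow, hδ2, hr']
    field_simp
    ring
  have hi_mem : i ∈ K⟮r₀⟯ := by
    have hw_mem : algebraMap K L δ * r₀ / (2 * q) ∈ K⟮r₀⟯ := by
      refine div_mem (mul_mem (IntermediateField.algebraMap_mem _ δ)
        (IntermediateField.mem_adjoin_simple_self K r₀)) ?_
      exact_mod_cast (natCast_mem K⟮r₀⟯ (2 * q))
    rcases sq_eq_sq_iff_eq_or_eq_neg.mp (hi2.trans hw2.symm) with h | h
    · rw [h]; exact hw_mem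
    · rw [h]; exact neg_mem hw_mem
  set i₀ : K⟮r₀⟯ := ⟨i, hi_mem⟩ with hi₀
  have hi₀2 : i₀ ^ 2 = -1 := by
    apply Subtype.ext
    simpa using hi2
  have hg : (cm7.baseChange K⟮r₀⟯).toAffine.Nonsingular 0 i₀ := by
    refine (Affine.equation_iff_nonsingular).mp ?_
    rw [Affine.equation_iff]
    simp [baseChange]
    linear_combination hi₀2
  have hgi : fHL (Affine.Point.some 0 i₀ hg) = Affine.Point.some 0 i hi := by
    rw [hfHL, Affine.Point.map_some]
    rfl
  -- the trace is `Gal(L/K)`-fixed, hence `K`-rational: `P = n • P_K`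
  set T : (cm7.baseChange L).toAffine.Point := ∑ σ : L ≃ₐ[K] L, Affine.Point.map (σ : L →ₐ[K] L) y₁
    with hT
  have hT' : T = ∑ σ : L ≃ₐ[K] L, (1 : ℤ) • Affine.Point.map (σ : L →ₐ[K] L) y₁ := by
    simp only [one_zsmul]; rfl
  obtain ⟨PK, hPK⟩ : ∃ PK : (cm7.baseChange K).toAffine.Point, fKL PK = T := by
    refine exists_map_eq_of_forall_map_galois_eq cm7 (k := K) fun τ => ?_
    rw [hT']
    exact map_sum_smul_map_eq_of_invariant cm7 τ (fun _ => (1 : ℤ)) (fun _ => rfl) y₁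
  have hPn : P = n • PK := by
    apply Affine.Point.map_injective (W' := cm7) (f := (algebraMap K L).toRatAlgHom)
    rw [map_zsmul]
    change fKL P = n • fKL PK
    rw [hPK, ← htr]
  -- descend the twisted trace and the genus half-trace to `K⟮r₀⟯`
  obtain ⟨yχ, hyχ⟩ := exists_map_adjoin_eq_twistedSum cm7 (k := K) hr y₁
  obtain ⟨Z, hZ⟩ := exists_map_adjoin_eq_genusHalfSum cm7 (k := K) hr y₁ 0 1
  have h2 : IsOfFinAddOrder (fKH PK - yχ - (2 : ℤ) • Z) := by
    have h0 : fKH PK - yχ - (2 : ℤ) • Z = 0 := by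
      apply hinjHL
      rw [map_sub, map_sub, map_zsmul, map_zero, hcomp, hPK]
      change T - fHL yχ - (2 : ℤ) • fHL Z = 0
      rw [hfHL, hyχ, hZ, hT, sum_map_sub_twistedSum_eq_two_smul cm7 r₀ y₁, sub_self]
    rw [h0]
    exact IsOfFinAddOrder.zero
  have h3 : IsOfFinAddOrder (μ • yχ - l • Affine.Point.some 0 i₀ hg) := by
    refine (hinjHL.isOfFinAddOrder_iff (f := fHL)).mp ?_
    rw [map_sub, map_zsmul, map_zsmul, hgi, hfHL, hyχ]
    exact hAt
  refine ⟨PK, hPn, fun R t ht hbad => ?_⟩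
  -- the generic descent lemma lives in the classical instance world of an abstract `H₀`; at `H₀ = K⟮r₀⟯` (a
  -- subtype of `L`) the point group of this file carries `Subtype`'s decidability, so the data are moved by `convert`
  -- (the `Decidable` instances are subsingletons), as in seat c3's `genusPointOddMultiple_witness`.
  have e : fKH PK = (2 : ℤ) • fKH R + fKH t := by rw [hbad, map_add, map_zsmul]
  have ht' : IsOfFinAddOrder (fKH t) := fKH.isOfFinAddOrder ht
  refine cm7_odd_zsmul_ne_two_zsmul_add_of_genusData hK hq hq7 hdK hfin hg (y := fKH PK) (y' := yχ) (Z := Z)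
    (μ := μ) (l := l) hl (by convert h2) (by convert h3) (k := 1) odd_one (fKH R) (fKH t)
    (by convert ht') ?_
  convert e
  exact one_zsmul _

end RatTrace

/-! ## §2 The index `[X₀(49)(K) : ℤP] = 2·|n|·(odd)` -/

/-- **`[X₀(49)(K) : ℤP] = |n·m| · 2` with `m` ODD** for `P = n • P_K`, `P_K ∉ 2X₀(49)(K) + tors`, when
`rank X₀(49)(K) = 1` (`X₀(49)(K)/tors = ℤḡ` by Mordell–Weil, `P_K ≡ m ḡ` with `m` odd, `#X₀(49)(K)_tors = 2` — file
B1c-α; index formula `KrizLi2019.index_zmultiples_eq`). [cite: SilvermanAEC2009, VIII.6] [cite: SilvermanTate2015, §3.5] -/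
theorem index_zmultiples_eq_of_oddType (hK : IsImaginaryQuadratic K) {q : ℕ} (hq : q.Prime)
    (hq7 : jacobiSym q 7 = -1) (hdK : NumberField.discr K = -(4 * (q : ℤ)))
    (hr : (cm7.baseChange K).mordellWeilRank = 1) {P PK : (cm7.baseChange K).toAffine.Point} {n : ℤ}
    (hn : n ≠ 0) (hP : P = n • PK)
    (hodd : ∀ R t : (cm7.baseChange K).toAffine.Point, IsOfFinAddOrder t → PK ≠ (2 : ℤ) • R + t) :
    ∃ m : ℤ, Odd m ∧ (AddSubgroup.zmultiples P).index = (n * m).natAbs * 2 := by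
  -- a Mordell–Weil basis with ONE element
  obtain ⟨P₁, hP₁⟩ := (cm7.baseChange K).exists_isMordellWeilBasis_holds
  have hB : IsMordellWeilBasis (P₁ ∘ finCongr hr.symm) := isMordellWeilBasis_comp_equiv hP₁ _
  set g := (P₁ ∘ finCongr hr.symm) 0 with hg_def
  have hg : ¬ IsOfFinAddOrder g := by
    intro hfin
    have hne := hB.1.ne_zero 0
    apply hne
    change (QuotientAddGroup.mk g : mordellWeilModTorsion (cm7.baseChange K)) = 0
    exact (QuotientAddGroup.eq_zero_iff _).mpr ((AddCommGroup.mem_torsion _).mpr hfin)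
  have hgen : ∀ y : (cm7.baseChange K).toAffine.Point, ∃ m : ℤ,
      y - m • g ∈ AddCommGroup.torsion (cm7.baseChange K).toAffine.Point := fun y => by
    obtain ⟨a, ha⟩ := exists_sub_zsmul_isOfFinAddOrder_of_isMordellWeilBasis hB y
    exact ⟨a, (AddCommGroup.mem_torsion _).mpr ha⟩
  obtain ⟨m, hm⟩ := exists_sub_zsmul_isOfFinAddOrder_of_isMordellWeilBasis hB PK
  have hmodd : Odd m := odd_of_sub_zsmul_isOfFinAddOrder hodd hm
  refine ⟨m, hmodd, ?_⟩
  have hm0 : m ≠ 0 := fun h => by simp [h] at hmodd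
  have hx : P - (n * m) • g ∈ AddCommGroup.torsion (cm7.baseChange K).toAffine.Point := by
    rw [hP, mul_smul, ← smul_sub, AddCommGroup.mem_torsion]
    rw [← AddCommGroup.mem_torsion] 
    exact AddSubgroup.zsmul_mem _ ((AddCommGroup.mem_torsion _).mpr hm) n
  rw [KrizLi2019.index_zmultiples_eq (cm7.baseChange K) hg hgen (mul_ne_zero hn hm0) hx,
    torsionOrder_cm7_baseChange_eq_two hK hq hq7 hdK]

/-! ## §3 THEOREM B: `X049BirchLemmaEvenDiscr` from Theorem A and print -/

/-- `2·#m` bookkeeping: `ord₂ (m²/(2·tq)) = 0` for `m` odd and `ord₂ tq = −1`. [folklore] -/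
theorem padicValRat_sq_div_two_mul {m : ℤ} (hm : Odd m) {t : ℚ} (ht0 : t ≠ 0) (ht : padicValRat 2 t = -1) :
    padicValRat 2 ((m : ℚ) ^ 2 / (2 * t)) = 0 := by
  haveI : Fact (Nat.Prime 2) := ⟨Nat.prime_two⟩
  have hm0 : (m : ℚ) ≠ 0 := by exact_mod_cast (fun h => by simp [h] at hm : m ≠ 0)
  have hvm : padicValRat 2 (m : ℚ) = 0 := by
    rw [padicValRat.of_int]
    simp only [Nat.cast_eq_zero]
    rw [padicValInt, padicValNat.eq_zero_of_not_dvd (fun h => ?_)]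
    exact (Int.not_even_iff_odd.mpr hm) (even_iff_two_dvd.mpr (Int.natAbs_dvd_natAbs.mp (by simpa using h)))
  rw [padicValRat.div (pow_ne_zero 2 hm0) (mul_ne_zero two_ne_zero ht0), padicValRat.pow,
    padicValRat.mul two_ne_zero ht0, hvm, ht,
    show padicValRat 2 (2 : ℚ) = 1 by simpa using padicValRat.self (p := 2) one_lt_two]
  norm_num

/-- **THEOREM B — `X049BirchLemmaEvenDiscr` HOLDS, granted THEOREM A (`X049GenusTheoremA`) and the line's printed
inputs by name.** For every prime `q` with `(q/7) = −1`, `K` imaginary quadratic with `d_K = −4q`, every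
level-`49` Heegner datum `(Dt, H, ι)` with point `P ∈ X₀(49)(K)`, every globally minimal `W = Cd • X₀(49)^{(d_K)}`
and the halvability value `k`: (i) `P` has infinite order and (ii) `ord₂ 𝔮₄₉ = 0`. Binders: `h36`, `hrec`
(Darmon 3.6 / Shimura reciprocity at conductor `1`, `∀K`), `hD₀` (a datum with `|c| = 1`), `hA` (THEOREM A), `hnf`
(Modularity), `h12` (CLTZ 2015 Thm 1.2), `hBF` (Burungale–Flach), `hGZ`, `hKo`, `hGZK`, `hHP`.
[cite: Gross1984, §§4–5] [cite: GrossLMS1991, §§3–4 (4.1)] [cite: CoatesLiTianZhai2015, Thm. 1.2 (p. 359)]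
[cite: BurungaleFlach2024, Thm. 1.1 and Cor. 2] [cite: GrossZagier1986, Thm. I.(6.3) and V.§2]
[cite: BurungaleCastellaSkinnerTian2022, Rem. D (p. 327)] -/
theorem x049BirchLemmaEvenDiscr_of_theoremA
    (h36 : ∀ (K : Type) [Field K] [NumberField K], phi_heegnerTau_mem_singularModuliField 49 cm7 K)
    (hrec : ∀ (K : Type) [Field K] [NumberField K], heegnerPointOfConductor_one_galoisConj 49 cm7 K)
    (hD₀ : ∃ D₀ : ModularParametrizationData cm7 49, |D₀.c| = 1) (hA : X049GenusTheoremA)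
    (hnf : ModularForms.exists_isNewformOf) (h12 : CoatesLiTianZhai2015.thm12_fullBSD_twist)
    (hBF : bsdTriple_of_hasCM_of_L_one_ne_zero)
    (hGZ : ∀ (N : ℕ) [NeZero N] (W : WeierstrassCurve ℚ) (K : Type) [Field K] [NumberField K],
      gross_zagier N W K)
    (hKo : ∀ (N : ℕ) [NeZero N] (W : WeierstrassCurve ℚ) (K : Type) [Field K] [NumberField K],
      kolyvagin N W K)
    (hGZK : rank_eq_analyticRank_of_analyticRank_le_one)
    (hHP : ∀ (W : WeierstrassCurve ℚ) (K : Type) [Field K] [NumberField K], exists_isHeegnerPoint W K) :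
    X049BirchLemmaEvenDiscr := by
  have hO : X049GenusPointOddMultiple := x049GenusPointOddMultiple_of_theoremA h36 hrec hD₀ hA
  obtain ⟨D₀, hc⟩ := hD₀
  intro q K _ _ Dt H ι P W _ _ Cd k hq hq7 hK hdK hPH hW hk hkiff
  haveI := Fact.mk hq
  have hq4 : q % 4 = 1 := emod_four_of_discr_eq hK hq hq7 hdK
  have hl7 : legendreSym q (-7) = -1 := by
    rw [jacobiSym.legendreSym.to_jacobiSym, jacobiSym_neg_seven_eq hq hq4]; exact hq7
  -- clause (i)
  have hPH' : IsHeegnerPoint 49 cm7 K P := ⟨Dt, H, ι, hPH⟩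
  have hPnt : ¬ IsOfFinAddOrder P := not_isOfFinAddOrder_heegnerPoint_of_genusOddMultiple hO hq hq7 K hK hdK hPH'
  refine ⟨hPnt, ?_⟩
  -- ranks: `r_an(W) = 1`, `rank W(ℚ) = 1`, `rank X₀(49)(K) = 1`
  obtain ⟨C, hC⟩ := exists_smul_eq_quadraticTwist_neg_of_discr K hdK W Cd hW
  obtain ⟨har, hrW, -, -, -⟩ := structure_inertPrimeTwist_of_genusOddMultiple hnf h12 hGZ hHP hGZK hO hq4 hl7 W C hC
  obtain ⟨-, hrK, -, -⟩ := shaAn_eq_x049Quotient_inertPrimeTwist hnf h12 hBF hGZ hKo hGZK hq7 K hK hdK Dt H ι P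
    hPH W Cd hW har
  -- `k = 1`
  have hk1 : k = 1 := by
    rcases hk with h | h
    · exact h
    · exact absurd (hkiff.mp h) (not_forall_halvable_inertPrimeTwist hK hq hq7 hdK W Cd hW hrW)
  -- the trace relation with the explicit scaling `n = D₀.c·Dt.c`
  have hH : SatisfiesHeegnerHypothesis 49 K := satisfiesHeegnerHypothesis_fortyNine_negFourMul hK hq7 hdK
  obtain ⟨d⟩ := exists_kolyvaginHeegnerData_one (h36 K) hK D₀ H.β ι H.dvd_sq_sub
  obtain ⟨hfd, hgal⟩ := finiteDimensional_and_isGalois_ringClassField hK ι one_ne_zero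
  haveI := hfd
  haveI := hgal
  obtain ⟨hn, htr⟩ := map_eq_zsmul_sum_algEquiv_of_abs_c_eq_one (hrec K) hK hH Dt D₀ hc H d hPH
  -- `√q ∈ K[1]` and THEOREM A for `d`
  obtain ⟨s, hs⟩ := IsAlgClosed.exists_pow_nat_eq (q : ℂ) two_pos
  have hmem : s ∈ ringClassField K ι 1 := sqrt_mem_ringClassField_one_of_discr_eq hK ι hq hq4 hdK s hs
  set r₀ : ringClassField K ι 1 := ⟨s, hmem⟩ with hr₀
  have hr : r₀ ^ 2 = algebraMap K (ringClassField K ι 1) ((q : ℕ) : K) := by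
    apply Subtype.ext
    rw [map_natCast]
    simpa using hs
  have hAt := theoremA_algEquiv hA D₀ hc hq hq7 hK hdK ι d r₀ hs
  -- the `K`-rational trace of odd type and the index
  obtain ⟨PK, hPK, hoddK⟩ := exists_ratTrace_oddType hK hq hq7 hdK P hr d.y htr hAt
  obtain ⟨m, hm, hI⟩ := index_zmultiples_eq_of_oddType hK hq hq7 hdK hrK hn hPK hoddK
  -- the other factors of `𝔮₄₉`
  have hd0 : (NumberField.discr K : ℚ) ≠ 0 := by exact_mod_cast NumberField.discr_ne_zero K
  haveI := cm7.isElliptic_quadraticTwist hd0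
  have hjW : W.j = -3375 ∨ W.j = 16581375 := by
    left
    subst hW
    rw [variableChange_j, j_quadraticTwist _ hd0, j_cm7]
  have htW : W.torsionOrder = 2 := torsionOrder_eq_two_of_j_eq W hjW
  have hninf : (cm7.baseChange ℝ).numRealComponents = 1 := numRealComponents_cm7
  have htK : (cm7.baseChange K).torsionOrder = 2 := torsionOrder_cm7_baseChange_eq_two hK hq hq7 hdK
  have hwK : Units.torsionOrder K = 2 :=
    QuadraticFields.Quadratic.torsionOrder_eq_two_of_discr_lt_neg_four hK.1 (by rw [hdK]; have := hq.two_le; omega)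
  have htq := padicValRat_two_twinQuotient_cm7 h12
  have htq0 := twinQuotient_cm7_ne_zero h12
  have hu : |(Cd.u : ℚ)| = 1 := abs_u_eq_one_of_smul_cm7_quadraticTwist_discr hK hq hq7 hdK W Cd hW
  have hcW : W.tamagawaProduct = 16 := tamagawaProduct_eq_sixteen_of_smul_eq hK hq hq7 hdK W Cd hW
  have hc0 : (Dt.c : ℚ) ≠ 0 := by exact_mod_cast Dt.maninConstant_ne_zero_holds
  have hD₀c : ((D₀.c : ℚ)) ^ 2 = 1 := by
    have h' : D₀.c ^ 2 = 1 := by rw [← sq_abs, hc, one_pow]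
    exact_mod_cast h'
  have hI2 : (((AddSubgroup.zmultiples P).index : ℕ) : ℚ) ^ 2 = 4 * (Dt.c : ℚ) ^ 2 * (m : ℚ) ^ 2 := by
    rw [hI, Nat.cast_mul, Nat.cast_natAbs, mul_pow, Int.cast_abs, sq_abs]
    push_cast
    linear_combination (4 * (Dt.c : ℚ) ^ 2 * (m : ℚ) ^ 2) * hD₀c
  -- `𝔮₄₉ = m² / (2 · tq)`
  have e : x049HeegnerTwistQuotient K P Dt.c k W Cd.u = (m : ℚ) ^ 2 / (2 * twinQuotient cm7) := by
    unfold x049HeegnerTwistQuotient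
    rw [hI2, htW, hninf, hk1, htK, hwK, hu, hcW]
    push_cast
    field_simp
    ring
  rw [e]
  exact padicValRat_sq_div_two_mul hm htq0 htq

/-- The same with the Manin input in tree currency (`OptimalCurveManinCertificate cm7` and `N(X₀(49)) = 49`, as in
seat c3's `x049GenusPointOddMultiple_of_theoremA_of_certificate`). [cite: AgasheRibetStein2006, Thm. 2.6]
[cite: CoatesLiTianZhai2015, Thm. 1.2] -/
theorem x049BirchLemmaEvenDiscr_of_theoremA_of_certificate
    (h36 : ∀ (K : Type) [Field K] [NumberField K], phi_heegnerTau_mem_singularModuliField 49 cm7 K)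
    (hrec : ∀ (K : Type) [Field K] [NumberField K], heegnerPointOfConductor_one_galoisConj 49 cm7 K)
    (h49 : cm7.conductorNorm ℤ = 49) (hM : OptimalCurveManinCertificate cm7) (hA : X049GenusTheoremA)
    (hnf : ModularForms.exists_isNewformOf) (h12 : CoatesLiTianZhai2015.thm12_fullBSD_twist)
    (hBF : bsdTriple_of_hasCM_of_L_one_ne_zero)
    (hGZ : ∀ (N : ℕ) [NeZero N] (W : WeierstrassCurve ℚ) (K : Type) [Field K] [NumberField K],
      gross_zagier N W K)
    (hKo : ∀ (N : ℕ) [NeZero N] (W : WeierstrassCurve ℚ) (K : Type) [Field K] [NumberField K],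
      kolyvagin N W K)
    (hGZK : rank_eq_analyticRank_of_analyticRank_le_one)
    (hHP : ∀ (W : WeierstrassCurve ℚ) (K : Type) [Field K] [NumberField K], exists_isHeegnerPoint W K) :
    X049BirchLemmaEvenDiscr := by
  obtain ⟨hN, D, -, hD, -⟩ := hM.exists_optimalDatum_abs_maninConstant_eq_one
  haveI := hN
  exact x049BirchLemmaEvenDiscr_of_theoremA h36 hrec (exists_datum_abs_c_eq_one_of_level_eq h49 D hD) hA hnf h12
    hBF hGZ hKo hGZK hHP

/-! ## §4 Consequences on the formula axis (twin″) and the rank axis (D(q)) for the WHOLE inert prime family -/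

/-- **TWIN″ ON THE WHOLE INERT PRIME-TWIST FAMILY, modulo THEOREM A: `BSD(W, 2)` (Miller's `BSDp W 2`) for EVERY
globally minimal model `W` of `49a1^{(−q)}` and EVERY prime `q ≡ 1 (mod 4)` with `(−7/q) = −1`** — the item
`BSDTwoCMSevenAdditiveRankOne` (twin″) restricted to the first infinite (density-zero) family of the additive cell,
granted `X049GenusTheoremA` and the printed inputs by name (seat c301 gen 4's `bsdp_two_inertPrimeTwist_of_birch`
fed with THEOREM B). Frontier-grade in print: additive-at-`2`, rank-one `BSD₂` for infinitely many CM twists (CLTZ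
2015 / CLZ: odd twist parameters only; BCST 2022 Rem. D names the even-discriminant gap).
[cite: Miller2011LMS, Def. 1.1] [cite: CoatesLiTianZhai2015, Thm. 1.2–1.4] [cite: BurungaleCastellaSkinnerTian2022, Rem. D (p. 327)] -/
theorem bsdp_two_inertPrimeTwist_of_theoremA
    (h36 : ∀ (K : Type) [Field K] [NumberField K], phi_heegnerTau_mem_singularModuliField 49 cm7 K)
    (hrec : ∀ (K : Type) [Field K] [NumberField K], heegnerPointOfConductor_one_galoisConj 49 cm7 K)
    (hD₀ : ∃ D₀ : ModularParametrizationData cm7 49, |D₀.c| = 1) (hA : X049GenusTheoremA)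
    (hnf : ModularForms.exists_isNewformOf) (h12 : CoatesLiTianZhai2015.thm12_fullBSD_twist)
    (hBF : bsdTriple_of_hasCM_of_L_one_ne_zero)
    (hGZ : ∀ (N : ℕ) [NeZero N] (W : WeierstrassCurve ℚ) (K : Type) [Field K] [NumberField K],
      gross_zagier N W K)
    (hKo : ∀ (N : ℕ) [NeZero N] (W : WeierstrassCurve ℚ) (K : Type) [Field K] [NumberField K],
      kolyvagin N W K)
    (hGZK : rank_eq_analyticRank_of_analyticRank_le_one)
    (hHP : ∀ (W : WeierstrassCurve ℚ) (K : Type) [Field K] [NumberField K], exists_isHeegnerPoint W K)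
    {q : ℕ} [Fact q.Prime] (hq4 : q % 4 = 1) (hq7 : legendreSym q (-7) = -1)
    (W : WeierstrassCurve ℚ) [W.IsElliptic] [W.IsGloballyMinimal] (C : VariableChange ℚ)
    (hC : C • W = cm7.quadraticTwist ((-q : ℤ) : ℚ)) : BSDp W 2 :=
  bsdp_two_inertPrimeTwist_of_birch hnf h12 hBF hGZ hKo hGZK hHP
    (x049BirchLemmaEvenDiscr_of_theoremA h36 hrec hD₀ hA hnf h12 hBF hGZ hKo hGZK hHP) hq4 hq7 W C hC

end Summit.BirchSwinnertonDyer.BirchSwinnertonDyer.Theorems.GoldfeldGoodTwists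

end
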